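/-
Origin: expansion seat `prover-pub-hodgecm-mc-sinst-1-g8-0`, handover #1234 2026-08-20T18:37Z md5 d5b0f653da96 (192 l.; NEW additive universe-free leaf, ns HodgeCM.WeightFormsHecke; imports #1233 + Vendored WeightFormsArchRestriction only; `heckeWFun Δ g f := x ↦ Σ_{q ∈ Δ/Δ'} f (g (out q)⁻¹ x)`, `heckeWFun_term_eq`, `heckeWFun_mem`, linear `heckeW`, `toGroupFun_hecke_eq_heckeWFun`/`toGroup_hecke` (u_{T_g F} = T_g u_F), `mul_rational`/`exists_corrector_mul_inv` (correctors multiply along rational products), `heckeWFun_comp_apply`/`heckeW_restrictHom_apply` (T_g downstairs = Σ_q R(k_q⁻¹) upstairs through ι); NAME LIST: HodgeCM.WeightFormsHecke.heckeWFun_mem · HodgeCM.WeightFormsHecke.toGroup_hecke · HodgeCM.WeightFormsHecke.heckeW_restrictHom_apply) (`HOME/mc/pub-hodgecm-mc-sinst-1-g8/stage/HodgeCM/Model/WeightFormsHecke.lean`, md5 d5b0f653da96, 192 lines);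
landed by the gen-24 packager (p-g24) in gate run 59 as `HodgeCM/Model/WeightFormsHecke.lean` (verbatim).
-/
/-
Copyright (c) 2026 the pub-hodgecm formalisation cell (harness21).  New file, not vendored.
Origin: session prover-pub-hodgecm-mc-sinst-1-g8-0 (unit pub-hodgecm-mc-sinst-1-g8, S-INSTANCE CONSTRUCTOR gen 8; section/adelic side of the
(J-Liu-Θ) junction behind E's row 9 `hΘ`, division of labour with binder-1-g15 STATUS 2026-08-20T18:25:02Z), 2026-08-20.
Intended final place: `HodgeCM/Model/WeightFormsHecke.lean` (NEW additive leaf, universe-free; imports `HodgeCM.Model.BallFormsHecke` (#1233) and the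
vendored `WeightFormsArchRestriction` only; nothing imports it; drop alone on bounce).
-/
import Summits.HodgeConjecture.HodgeCM.Model.BallFormsHecke
import Literature.NumberTheory.Automorphic.WeightFormsArchRestriction

set_option autoImplicit false

/-!
# The Hecke operator on weight forms on the group, and its reading through `toGroup` and `restrictHom`

KERNEL definitions and lemmas over the vendored `weightForms Δ κ₁ τ₁` (functions on a group `G₁`, left `Δ`-invariant, right `τ₁`-equivariant)
and `WeightForms.restrictHom` (the adelic → archimedean dictionary); nothing cited anew, nothing minted.  For `g ∈ G₁` with
`Δ' = Δ ∩ g⁻¹Δg` (`BallFormsHecke.heckeStab Δ g`) of finite index in `Δ`: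
* `heckeWFun Δ g f := x ↦ Σ_{γΔ' ∈ Δ/Δ'} f (g γ⁻¹ x)` — the classical `T_g = T_{Δ g Δ}` on functions on the group ([Shimura 1971 §3.4 (3.4.1)]
  as in the vendored Hecke file's docstring; a DEFINITION over real carriers); `heckeWFun_term_eq` (independence of the representative for
  left-`Δ`-invariant `f`); `heckeWFun_mem` (weight forms ↦ weight forms); the linear map `heckeW Δ g : weightForms Δ κ₁ τ₁ →ₗ weightForms Δ κ₁ τ₁`;
* `toGroupFun_hecke_eq_heckeWFun` / `toGroup_hecke` — **`T_g` on sections of an automorphy factor (#1233 `BallFormsHecke.hecke`) read on the group IS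
  `T_g` on weight forms**: `u_{T_g F} = T_g u_F`;
* `mul_rational` — finite-adelic correctors multiply along rational products (`ι ρ · k ∈ ΓU`, `ι ρ' · k' ∈ ΓU`, `k` centralising `ι(G₁)` ⇒
  `ι (ρρ') · (k k') ∈ ΓU`), so the representatives `g γ⁻¹` of `Δ g Δ` are rational with correctors `k · κ(c_γ)`;
* `heckeWFun_comp_apply` — **`T_g` through `restrictHom`**: for `F` left-`ΓU`-invariant upstairs and rational representatives with correctors
  `k_q`, `(T_g (F ∘ ι)) x = Σ_q F (ι x · k_q⁻¹)` — downstairs the classical Hecke operator, upstairs a sum of RIGHT translates by finite-adelic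
  elements (the seam `comp_leftTranslate_eq` summed over the double coset).
The theta-side corollary (the summands are restricted THETA forms of the translated situations, `Model/ThetaSpaceSatTranslate`) is the sibling leaf
`Model/ThetaSpaceSatHecke`.  0 proof holes, 0 `axiom`; `#print axioms` ⊆ {propext, Classical.choice, Quot.sound}.
-/

noncomputable section

open Literature.NumberTheory.Automorphic
open Literature.NumberTheory.Automorphic.AutomorphyFactor
open Literature.NumberTheory.Automorphic.WeightForms (restrictHom restrictHom_apply IsLevelCorrected IsWeightMatched
  comp_leftTranslate_eq)
open HodgeCM.BallFormsHecke (heckeStab mem_heckeStab_iff heckeStab_le hecke toGroupFun_hecke)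

namespace HodgeCM

namespace WeightFormsHecke

variable {G₁ : Type*} [Group G₁] {K₁ : Type*} [Group K₁]
variable {R : Type*} [CommRing R] {W : Type*} [AddCommGroup W] [Module R W]
variable {Δ : Subgroup G₁} {κ₁ : K₁ →* G₁} {τ₁ : Representation R K₁ W}

/-! ### The Hecke operator on functions on the group -/

/-- **The Hecke operator `T_g = T_{Δ g Δ}` on functions on the group**: `(T_g f)(x) = Σ_{γΔ' ∈ Δ/Δ'} f (g γ⁻¹ x)`, `Δ' = Δ ∩ g⁻¹ Δ g`
(representatives `γ = out q`; representative-free on left-`Δ`-invariant `f`, `heckeWFun_term_eq`). [cite: Shimura1973, §3.4 (3.4.1)] -/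
def heckeWFun (Δ : Subgroup G₁) (g : G₁) [Fintype (Δ ⧸ (heckeStab Δ g).subgroupOf Δ)] (f : G₁ → W) : G₁ → W :=
  fun x => ∑ q : Δ ⧸ (heckeStab Δ g).subgroupOf Δ, f (g * (((Quotient.out q : Δ) : G₁))⁻¹ * x)

/-- Unfolding. [folklore] -/
theorem heckeWFun_apply (Δ : Subgroup G₁) (g : G₁) [Fintype (Δ ⧸ (heckeStab Δ g).subgroupOf Δ)] (f : G₁ → W) (x : G₁) :
    heckeWFun Δ g f x = ∑ q : Δ ⧸ (heckeStab Δ g).subgroupOf Δ, f (g * (((Quotient.out q : Δ) : G₁))⁻¹ * x) :=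
  rfl

omit [AddCommGroup W] in
/-- **Independence of the representative**: for `f` left-`Δ`-invariant, `f (g (out γΔ')⁻¹ x) = f (g γ⁻¹ x)` (`out (γΔ') = γ δ'` with
`δ' ∈ Δ' ⊆ g⁻¹Δg`, and `g δ'⁻¹ γ⁻¹ x = (g δ'⁻¹ g⁻¹) (g γ⁻¹ x)`). [folklore] -/
theorem heckeWFun_term_eq {Δ : Subgroup G₁} {g : G₁} {f : G₁ → W} (hf : ∀ δ ∈ Δ, ∀ x, f (δ * x) = f x) (γ : Δ) (x : G₁) :
    f (g * (((Quotient.out (γ : Δ ⧸ (heckeStab Δ g).subgroupOf Δ) : Δ) : G₁))⁻¹ * x) = f (g * ((γ : G₁))⁻¹ * x) := by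
  have h : (γ : Δ)⁻¹ * Quotient.out (γ : Δ ⧸ (heckeStab Δ g).subgroupOf Δ) ∈ (heckeStab Δ g).subgroupOf Δ :=
    QuotientGroup.leftRel_apply.mp (Quotient.exact (Quotient.out_eq (γ : Δ ⧸ (heckeStab Δ g).subgroupOf Δ)).symm)
  have hδ : ((γ : G₁))⁻¹ * ((Quotient.out (γ : Δ ⧸ (heckeStab Δ g).subgroupOf Δ) : Δ) : G₁) ∈ heckeStab Δ g := by
    simpa [Subgroup.mem_subgroupOf] using h
  set δ : G₁ := ((γ : G₁))⁻¹ * ((Quotient.out (γ : Δ ⧸ (heckeStab Δ g).subgroupOf Δ) : Δ) : G₁) with hδ_def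
  have hout : ((Quotient.out (γ : Δ ⧸ (heckeStab Δ g).subgroupOf Δ) : Δ) : G₁) = (γ : G₁) * δ := by rw [hδ_def]; group
  rw [hout, show g * ((γ : G₁) * δ)⁻¹ * x = (g * δ⁻¹ * g⁻¹) * (g * ((γ : G₁))⁻¹ * x) by group]
  exact hf _ (by
    have := (mem_heckeStab_iff.mp (Subgroup.inv_mem _ hδ)).2
    exact this) _

/-- **`T_g` carries weight forms to weight forms**: left `Δ`-invariance by reindexing the cosets (`q ↦ δ⁻¹ • q`), right `τ₁`-equivariance
termwise. [cite: Shimura1973, §3.4] -/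
theorem heckeWFun_mem {Δ : Subgroup G₁} {g : G₁} [Fintype (Δ ⧸ (heckeStab Δ g).subgroupOf Δ)] {f : G₁ → W}
    (hf : f ∈ weightForms Δ κ₁ τ₁) : heckeWFun Δ g f ∈ weightForms Δ κ₁ τ₁ := by
  refine WeightForms.mem_iff.mpr ⟨fun δ hδ x => ?_, fun u x => ?_⟩
  · rw [heckeWFun_apply, heckeWFun_apply]
    refine Fintype.sum_equiv (MulAction.toPerm (⟨δ, hδ⟩⁻¹ : Δ)) _ _ fun q => ?_
    induction q using QuotientGroup.induction_on with
    | H γ =>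
      rw [MulAction.toPerm_apply, MulAction.Quotient.smul_coe, heckeWFun_term_eq hf.1, heckeWFun_term_eq hf.1]
      congr 1
      simp only [smul_eq_mul, Subgroup.coe_mul, InvMemClass.coe_inv]
      group
  · rw [heckeWFun_apply, heckeWFun_apply, map_sum]
    refine Finset.sum_congr rfl fun q _ => ?_
    rw [← mul_assoc, hf.2 u]

variable (κ₁ τ₁) in
/-- **The Hecke operator `T_g` on weight forms** `weightForms Δ κ₁ τ₁ →ₗ[R] weightForms Δ κ₁ τ₁`. [cite: Shimura1973, §3.4 (3.4.1)] -/
def heckeW (Δ : Subgroup G₁) (g : G₁) [Fintype (Δ ⧸ (heckeStab Δ g).subgroupOf Δ)] :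
    weightForms Δ κ₁ τ₁ →ₗ[R] weightForms Δ κ₁ τ₁ where
  toFun f := ⟨heckeWFun Δ g f, heckeWFun_mem f.2⟩
  map_add' f f' := by
    ext x
    simp only [Submodule.coe_add, heckeWFun_apply, Pi.add_apply, Finset.sum_add_distrib]
  map_smul' c f := by
    ext x
    simp only [Submodule.coe_smul, heckeWFun_apply, Pi.smul_apply, Finset.smul_sum, RingHom.id_apply]

/-- `heckeW` on points. [folklore] -/
@[simp] theorem coe_heckeW (Δ : Subgroup G₁) (g : G₁) [Fintype (Δ ⧸ (heckeStab Δ g).subgroupOf Δ)] (f : weightForms Δ κ₁ τ₁) :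
    (heckeW κ₁ τ₁ Δ g f : G₁ → W) = heckeWFun Δ g f :=
  rfl

/-! ### `T_g` on sections read on the group -/

section ToGroup

variable {Y V : Type*} [MulAction G₁ Y] [AddCommGroup V] [Module R V] {A : G₁ → Y → Module.End R V}

/-- **`u_{T_g F} = T_g u_F`**: the group function of the Hecke operator on sections (#1233 `BallFormsHecke.hecke`) is the Hecke operator on
functions on the group applied to the group function. [cite: Shimura1973, §8.3 (8.3.2)] -/
theorem toGroupFun_hecke_eq_heckeWFun (hA : IsPullbackCocycle A) (o : Y) {Γ : Subgroup G₁} {g : G₁}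
    [Fintype (Γ ⧸ (heckeStab Γ g).subgroupOf Γ)] (F : Y → V) :
    toGroupFun A o (hecke A Γ g F) = heckeWFun Γ g (toGroupFun A o F) := by
  funext x
  rw [toGroupFun_hecke hA o, heckeWFun_apply]
  exact Finset.sum_congr rfl fun q _ => by rw [mul_assoc]

/-- The same through the linear maps `toGroup` / `heckeW` on a `Γ`-form. [folklore] -/
theorem toGroup_hecke (hA : IsPullbackCocycle A) (o : Y) {Γ : Subgroup G₁} {g : G₁}
    [Fintype (Γ ⧸ (heckeStab Γ g).subgroupOf Γ)] (F : factorForms Γ A) :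
    toGroup hA o ⟨hecke A Γ g F, BallFormsHecke.hecke_mem_factorForms hA F.2⟩ =
      heckeW _ _ Γ g (toGroup hA o F) :=
  Subtype.ext (toGroupFun_hecke_eq_heckeWFun hA o F)

end ToGroup

/-! ### `T_g` through the archimedean restriction: rational representatives and their finite-adelic correctors -/

section Restrict

variable {GU : Type*} [Group GU] {ΓU : Subgroup GU} (ι : G₁ →* GU)

/-- **Correctors multiply along rational products**: if `ι ρ · k ∈ ΓU` with `k` centralising `ι(G₁)` and `ι ρ' · k' ∈ ΓU`, then
`ι (ρ ρ') · (k k') ∈ ΓU` (`ι ρ ι ρ' k k' = (ι ρ k)(ι ρ' k')`). [folklore] -/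
theorem mul_rational {ρ ρ' : G₁} {k k' : GU} (hρ : ι ρ * k ∈ ΓU) (hk : ∀ x : G₁, Commute k (ι x)) (hρ' : ι ρ' * k' ∈ ΓU) :
    ι (ρ * ρ') * (k * k') ∈ ΓU := by
  have : ι (ρ * ρ') * (k * k') = (ι ρ * k) * (ι ρ' * k') := by
    rw [map_mul, mul_assoc, mul_assoc, ← mul_assoc (ι ρ') k k', ← (hk ρ').eq, mul_assoc]
  rw [this]
  exact ΓU.mul_mem hρ hρ'

/-- The product of two elements centralising `ι(G₁)` centralises `ι(G₁)`. [folklore] -/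
theorem commute_mul {k k' : GU} (hk : ∀ x : G₁, Commute k (ι x)) (hk' : ∀ x : G₁, Commute k' (ι x)) (x : G₁) :
    Commute (k * k') (ι x) :=
  Commute.mul_left (hk x) (hk' x)

/-- **Every representative `g γ⁻¹` of `Δ g Δ` is rational** when `g` is (corrector `k`) and `Δ` is level-corrected (corrector `κ c` of `γ⁻¹`):
corrector `k · κ c`. [folklore] -/
theorem exists_corrector_mul_inv {Kc : Type*} [Group Kc] {κ : Kc →* GU} {τ : Representation R Kc W}
    (hΔ : IsLevelCorrected ΓU κ τ ι Δ) {g : G₁} {k : GU} (hg : ι g * k ∈ ΓU) (hk : ∀ x : G₁, Commute k (ι x))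
    {γ : G₁} (hγ : γ ∈ Δ) :
    ∃ c : Kc, τ c = 1 ∧ ι (g * γ⁻¹) * (k * κ c) ∈ ΓU ∧ ∀ x : G₁, Commute (k * κ c) (ι x) := by
  obtain ⟨c, hc1, hmem, hcomm⟩ := hΔ γ⁻¹ (Δ.inv_mem hγ)
  exact ⟨c, hc1, mul_rational ι hg hk hmem, commute_mul ι hk hcomm⟩

/-- **`T_g` through the restriction**: for `F` left-`ΓU`-invariant and rational representatives `g (out q)⁻¹` with finite-adelic correctors `k q`
(`ι (g (out q)⁻¹) · k q ∈ ΓU`, `k q` centralising `ι(G₁)`), the classical Hecke operator downstairs is a sum of right translates upstairs: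
`(T_g (F ∘ ι)) x = Σ_q F (ι x · (k q)⁻¹)`. [folklore] -/
theorem heckeWFun_comp_apply {Δ : Subgroup G₁} {g : G₁} [Fintype (Δ ⧸ (heckeStab Δ g).subgroupOf Δ)]
    {F : GU → W} (hF : ∀ γ ∈ ΓU, ∀ y, F (γ * y) = F y) (k : Δ ⧸ (heckeStab Δ g).subgroupOf Δ → GU)
    (hk : ∀ q : Δ ⧸ (heckeStab Δ g).subgroupOf Δ, ι (g * (((Quotient.out q : Δ) : G₁))⁻¹) * k q ∈ ΓU)
    (hkc : ∀ q (x : G₁), Commute (k q) (ι x)) (x : G₁) :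
    heckeWFun Δ g (F ∘ ι) x = ∑ q : Δ ⧸ (heckeStab Δ g).subgroupOf Δ, F (ι x * (k q)⁻¹) := by
  rw [heckeWFun_apply]
  exact Finset.sum_congr rfl fun q _ => comp_leftTranslate_eq ι hF (hk q) (hkc q) x

/-- The same for an adelic weight form and the vendored `restrictHom`. [folklore] -/
theorem heckeW_restrictHom_apply {Kc : Type*} [Group Kc] {κ : Kc →* GU} {τ : Representation R Kc W}
    {hΔ : IsLevelCorrected ΓU κ τ ι Δ} {η₁ : K₁ →* Kc} {hη : IsWeightMatched κ τ ι κ₁ τ₁ η₁}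
    {g : G₁} [Fintype (Δ ⧸ (heckeStab Δ g).subgroupOf Δ)] (F : weightForms ΓU κ τ)
    (k : Δ ⧸ (heckeStab Δ g).subgroupOf Δ → GU)
    (hk : ∀ q : Δ ⧸ (heckeStab Δ g).subgroupOf Δ, ι (g * (((Quotient.out q : Δ) : G₁))⁻¹) * k q ∈ ΓU)
    (hkc : ∀ q (x : G₁), Commute (k q) (ι x)) (x : G₁) :
    (heckeW κ₁ τ₁ Δ g (restrictHom ι hΔ hη F) : G₁ → W) x =
      ∑ q : Δ ⧸ (heckeStab Δ g).subgroupOf Δ, (F : GU → W) (ι x * (k q)⁻¹) :=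
  heckeWFun_comp_apply ι F.2.1 k hk hkc x

end Restrict

end WeightFormsHecke

end HodgeCM

end
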